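import Summits.BirchSwinnertonDyer.Rank1Residual.X11b.KummerLocalIndex
import Literature.NumberTheory.EllipticCurves.SelmerFiniteProofs
import Literature.NumberTheory.EllipticCurves.BSDSelmerProofs
import HarnessLib

/-!
# Class X11b, routes p2/R1: PART A — Selmer classes trivial at one place are bounded by
# `#Ш[n]` times a Kummer kernel: `#(Sel⁽ⁿ⁾ ∩ ker res_E)·[E(E):nE(E)] ≤ #Ш[n]·[E(K):nE(K)]·[E(E):nE(E)+im E(K)]`
# (cell `b2b-bsdres`, sub-cell `multr1-p2`, gen 15)

HONEST FRAMING (verbatim, cell `b2b-bsdres`): the goal of the cell is to DELETE the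
COMBINATION-SHAPED residual classes for ALL analytic-rank `≤ 1` curves over `ℚ` — "full BSD
formula for every rank `≤ 1` curve in class `C`" assembled STRICTLY from published theorems — so
that the rank-`≤ 1` remainder becomes exactly the CONSTRUCTION-SHAPED classes, which are TYPED
(missing-input Props), NOT attempted; this is not "finishing BSD". Research route `p2` for class
X11b; no claim beyond the stated class; nothing booked; X11b stays CONSTRUCTION-SHAPED. Theorems only; no `sorry`; no named fact.

## What this file proves (namespace `Summit.BirchSwinnertonDyer.Rank1Residual.X11b.StrictAtPlace`)

For an elliptic curve `E = W` over a number field `K`, `n ≠ 0`, and a `K`-field `E` of characteristic `0`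
(a completion `K_v`), with `res_E : H¹(K, E[n]) → H¹(Γ_E, E[n])`, `Sel⁽ⁿ⁾ = selmerGroup W n`,
`Ш[n] = W.sha ⊓ H¹(K,E)[n]`, `κ_n = kummerMapTorsion`, `ι = Affine.Point.baseChange K E : E(K) → (W⁄E)(E)`:

* `natCard_le_mul_natCard_inf_ker` — `#A ≤ #T · #(A ⊓ ker f)` for `f(A) ≤ T`, `T` finite;
* `kummerMapTorsion_mem_selmerGroup` — Kummer classes are Selmer classes;
* **`natCard_selmerGroup_inf_ker_res_le`**: `#(Sel⁽ⁿ⁾ ∩ ker res_E) ≤ #Ш[n] · #(κ_n(E(K)) ∩ ker res_E)`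
  (the exact sequence `0 → E(K)/n → Sel⁽ⁿ⁾ → Ш[n] → 0`: tree `map_torsionH1ToH1_selmerGroup_holds`,
  `mem_range_kummerMapTorsion_of_torsionH1ToH1_eq_zero`, `finite_selmerGroup_holds`);
* `natCard_range_kummerMapTorsion_inf_ker_res`: `#(κ_n(E(K)) ∩ ker res_E) = [ι⁻¹(n(W⁄E)(E)) : nE(K)]`
  (`res_E κ_n P = κ_{n,E}(P_E)`, `KummerIndex.res_kummerMapTorsion_eq_localKummerMap`; kernels `nE(K)`,
  `n(W⁄E)(E)`);
* `relIndex_comap_mul_index`: `[ι⁻¹(n(W⁄E)(E)) : nE(K)]·[(W⁄E)(E) : n(W⁄E)(E)] = [E(K):nE(K)]·[(W⁄E)(E) : n(W⁄E)(E) + im E(K)]`;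
* **`natCard_selmerGroup_inf_ker_res_mul_index_le`** (assembled):
  `#(Sel⁽ⁿ⁾ ∩ ker res_E) · [(W⁄E)(E) : n(W⁄E)(E)] ≤ #Ш[n] · [E(K) : nE(K)] · [(W⁄E)(E) : n(W⁄E)(E) + im E(K)]`.

Role for route p2 ("Part A" of the input (d) `P2SelmerCardBoundAt`, Steps 1–2 of JSW Prop. 3.2.1): at
`E = K_𝔭` with (iv) and `rank E(K) = 1`, `[E(K):p^kE(K)] = [E(K_𝔭):p^kE(K_𝔭)] = p^k` and the last index
is `p^{min(k,e)}`, `e = (ord_p log_ω P − 1) − ord_p[E(K):ℤP] + ord_p c_p` (`BDPRouteLocalIndex`), so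
`#(Sel⁽p^k⁾ ∩ ker res_𝔭) ≤ #Ш[p^k]·p^e`; with `BDPRouteRelaxation` (Part B at `𝔭̄`) and the limit layer
(sibling sub-cell `multr1-p1`) this bounds Castella's `#Sel_𝔭(K, E[p^∞])`. Nothing booked; labels unchanged.

References: [JetchevSkinnerWan2017] Prop. 3.2.1 (arXiv:1512.06894 pp. 10–11); [SilvermanAEC2009]
VIII.§2, X.§4, Thm. X.4.2; [Castella2018] (3.2.1).
-/

noncomputable section

open scoped Classical

universe u

namespace Summit.BirchSwinnertonDyer.Rank1Residual.X11b.StrictAtPlace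

open WeierstrassCurve Literature.NumberTheory.EllipticCurves Literature.NumberTheory.GaloisRepresentations
  Field Function

section General

variable {G H Q : Type*} [AddCommGroup G] [AddCommGroup H]

/-- For `f : G →+ H` and subgroups `A ≤ G`, `T ≤ H` with `f(A) ≤ T` and `T` finite:
`#A ≤ #T · #(A ⊓ ker f)`. [folklore] -/
theorem natCard_le_mul_natCard_inf_ker (f : G →+ H) (A : AddSubgroup G) (T : AddSubgroup H)
    [Finite T] (hAT : A.map f ≤ T) :
    Nat.card A ≤ Nat.card T * Nat.card ↥(A ⊓ f.ker) := by
  -- restrict `f` to `A`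
  set g : A →+ H := f.comp A.subtype with hg
  have hker : Nat.card g.ker = Nat.card ↥(A ⊓ f.ker) := by
    refine Nat.card_congr ⟨fun x => ⟨x.1.1, x.1.2, x.2⟩, fun y => ⟨⟨y.1, y.2.1⟩, y.2.2⟩,
      fun _ => rfl, fun _ => rfl⟩
  have hle : g.range ≤ T := by
    rintro _ ⟨x, rfl⟩
    exact hAT ⟨x.1, x.2, rfl⟩
  have hrange : Nat.card g.range ≤ Nat.card T := AddSubgroup.card_le_of_le hle
  have h := AddSubgroup.card_mul_index g.ker
  rw [AddSubgroup.index_ker, hker] at h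
  calc Nat.card A = Nat.card ↥(A ⊓ f.ker) * Nat.card g.range := h.symm
    _ ≤ Nat.card ↥(A ⊓ f.ker) * Nat.card T := Nat.mul_le_mul_left _ hrange
    _ = Nat.card T * Nat.card ↥(A ⊓ f.ker) := mul_comm _ _

end General

variable {K : Type u} [Field K] [NumberField K] (W : WeierstrassCurve K) [W.IsElliptic]
variable (E : Type u) [Field E] [Algebra K E] [CharZero E] {n : ℤ} (hn : n ≠ 0)

omit [W.IsElliptic] in
/-- Kummer classes of rational points are Selmer classes. [cite: SilvermanAEC2009, X.§4 diagram (**)] -/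
theorem kummerMapTorsion_mem_selmerGroup (hdiv : ∀ P : geomPoints W, ∃ Q : geomPoints W, n • Q = P)
    (P : W.toAffine.Point) : kummerMapTorsion W n hdiv P ∈ selmerGroup W n :=
  (W.mem_selmerGroup_iff n _).mpr
    ⟨fun _ => kummerMapTorsion_mem_selmerLocalKer W n hdiv _ P,
      fun _ => kummerMapTorsion_mem_selmerLocalKer W n hdiv _ P⟩

include hn in
omit [CharZero E] in
/-- **Part A at finite level.** The classes of `Sel⁽ⁿ⁾(E/K)` dying in `H¹(Γ_E, E[n])` (`E` a `K`-field,
e.g. `K_v`) number at most `#Ш(E/K)[n]` times the number of Kummer classes `κ_n(P)`, `P ∈ E(K)`, dying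
in `H¹(Γ_E, E[n])` — from `0 → E(K)/n → Sel⁽ⁿ⁾ → Ш[n] → 0` (tree `map_torsionH1ToH1_selmerGroup_holds`,
`mem_range_kummerMapTorsion_of_torsionH1ToH1_eq_zero`, `finite_selmerGroup_holds`).
[cite: SilvermanAEC2009, Thm X.4.2] [cite: JetchevSkinnerWan2017, Prop. 3.2.1 (proof)] -/
theorem natCard_selmerGroup_inf_ker_res_le
    (hdiv : ∀ P : geomPoints W, ∃ Q : geomPoints W, n • Q = P) :
    Nat.card ↥(selmerGroup W n ⊓ (galoisCohomology.res (W.torsionGaloisModule n) E 1).ker) ≤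
      Nat.card ↥(W.sha ⊓ AddSubgroup.torsionBy W.galH1 n) *
        Nat.card ↥((kummerMapTorsion W n hdiv).range ⊓
          (galoisCohomology.res (W.torsionGaloisModule n) E 1).ker) := by
  haveI : PerfectField K := PerfectField.ofCharZero
  haveI : Finite (selmerGroup W n) := W.finite_selmerGroup_holds hn
  set C : AddSubgroup (galH1Torsion W n) := (galoisCohomology.res (W.torsionGaloisModule n) E 1).ker
  have hSha : (selmerGroup W n).map (torsionH1ToH1 W n) = W.sha ⊓ AddSubgroup.torsionBy W.galH1 n :=
    W.map_torsionH1ToH1_selmerGroup_holds hn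
  haveI : Finite ↥(W.sha ⊓ AddSubgroup.torsionBy W.galH1 n) := by
    rw [← hSha]
    exact Finite.of_surjective (fun x : selmerGroup W n =>
      (⟨torsionH1ToH1 W n x, x, x.2, rfl⟩ : (selmerGroup W n).map (torsionH1ToH1 W n)))
      (by rintro ⟨_, x, hx, rfl⟩; exact ⟨⟨x, hx⟩, rfl⟩)
  have h1 := natCard_le_mul_natCard_inf_ker (torsionH1ToH1 W n) (selmerGroup W n ⊓ C)
    (W.sha ⊓ AddSubgroup.torsionBy W.galH1 n) ((AddSubgroup.map_mono inf_le_left).trans hSha.le)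
  -- the kernel classes are Kummer classes
  have hsub : (selmerGroup W n ⊓ C) ⊓ (torsionH1ToH1 W n).ker ≤ (kummerMapTorsion W n hdiv).range ⊓ C := by
    rintro x ⟨⟨-, hxC⟩, hxker⟩
    exact ⟨mem_range_kummerMapTorsion_of_torsionH1ToH1_eq_zero W n hdiv x hxker, hxC⟩
  haveI : Finite ↥((kummerMapTorsion W n hdiv).range ⊓ C) :=
    Finite.Set.subset (selmerGroup W n : Set (galH1Torsion W n)) (by
      rintro x ⟨⟨P, rfl⟩, -⟩
      exact kummerMapTorsion_mem_selmerGroup W hdiv P)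
  exact h1.trans (Nat.mul_le_mul_left _ (AddSubgroup.card_le_of_le hsub))

include hn in
/-- **The Kummer classes dying at `E` come from `ι⁻¹(n·(W⁄E)(E))`**: with `S = {P ∈ E(K) : P_E ∈ n(W⁄E)(E)}`,
`#(κ_n(E(K)) ⊓ ker res_E) = [S : nE(K)]` (`κ_n` has kernel `nE(K)` and `res_E κ_n P = κ_{n,E}(P_E)`
has kernel `S`). [cite: SilvermanAEC2009, VIII.§2 and X.§4 diagram (**)] -/
theorem natCard_range_kummerMapTorsion_inf_ker_res
    (hdiv : ∀ P : geomPoints W, ∃ Q : geomPoints W, n • Q = P) :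
    Nat.card ↥((kummerMapTorsion W n hdiv).range ⊓
        (galoisCohomology.res (W.torsionGaloisModule n) E 1).ker) =
      ((zsmulAddGroupHom n : W.toAffine.Point →+ _).range).relIndex
        (((zsmulAddGroupHom n : (W.baseChange E).toAffine.Point →+ _).range).comap
          (Affine.Point.baseChange (W' := W) K E)) := by
  haveI : PerfectField K := PerfectField.ofCharZero
  set κ := kummerMapTorsion W n hdiv with hκ
  set S : AddSubgroup W.toAffine.Point :=
    ((zsmulAddGroupHom n : (W.baseChange E).toAffine.Point →+ _).range).comap
      (Affine.Point.baseChange (W' := W) K E) with hS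
  -- `κ(S) = κ(E(K)) ⊓ ker res_E`
  have hmap : S.map κ = κ.range ⊓ (galoisCohomology.res (W.torsionGaloisModule n) E 1).ker := by
    have key : ∀ P : W.toAffine.Point,
        galoisCohomology.res (W.torsionGaloisModule n) E 1 (κ P) = 0 ↔ P ∈ S := by
      intro P
      rw [hκ, KummerIndex.res_kummerMapTorsion_eq_localKummerMap W E hn hdiv P, ← AddMonoidHom.mem_ker,
        W.ker_localKummerMap E hn, hS, AddSubgroup.mem_comap]
      exact Iff.rfl
    apply le_antisymm
    · rintro _ ⟨P, hP, rfl⟩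
      exact ⟨⟨P, rfl⟩, AddMonoidHom.mem_ker.mpr ((key P).mpr hP)⟩
    · rintro _ ⟨⟨P, rfl⟩, hP⟩
      exact ⟨P, (key P).mp (AddMonoidHom.mem_ker.mp hP), rfl⟩
  rw [← hmap, ← AddSubgroup.relIndex_ker, hκ, kummerMapTorsion_ker]

omit [NumberField K] [W.IsElliptic] [CharZero E] in
/-- **Index bookkeeping**: with `S = ι⁻¹(n(W⁄E)(E))`,
`[S : nE(K)] · [(W⁄E)(E) : n(W⁄E)(E)] = [E(K) : nE(K)] · [(W⁄E)(E) : n(W⁄E)(E) + im E(K)]`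
(`E(K)/S ≅ (im E(K) + n(W⁄E)(E))/n(W⁄E)(E)`). [folklore] -/
theorem relIndex_comap_mul_index :
    ((zsmulAddGroupHom n : W.toAffine.Point →+ _).range).relIndex
        (((zsmulAddGroupHom n : (W.baseChange E).toAffine.Point →+ _).range).comap
          (Affine.Point.baseChange (W' := W) K E)) *
      ((zsmulAddGroupHom n : (W.baseChange E).toAffine.Point →+ _).range).index =
    ((zsmulAddGroupHom n : W.toAffine.Point →+ _).range).index *
      ((Affine.Point.baseChange (W' := W) K E).range ⊔
        (zsmulAddGroupHom n : (W.baseChange E).toAffine.Point →+ _).range).index := by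
  set ι := Affine.Point.baseChange (W' := W) K E with hι
  set NK := (zsmulAddGroupHom n : W.toAffine.Point →+ _).range with hNK
  set NE := (zsmulAddGroupHom n : (W.baseChange E).toAffine.Point →+ _).range with hNE
  have hle : NK ≤ NE.comap ι := by
    rintro _ ⟨P, rfl⟩
    exact ⟨ι P, (map_zsmul ι n P).symm⟩
  have h1 : NK.relIndex (NE.comap ι) * (NE.comap ι).index = NK.index := AddSubgroup.relIndex_mul_index hle
  have h2 : (NE.comap ι).index = NE.relIndex ι.range := AddSubgroup.index_comap NE ι
  have h3 : NE.relIndex (ι.range ⊔ NE) * (ι.range ⊔ NE).index = NE.index :=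
    AddSubgroup.relIndex_mul_index le_sup_right
  have h4 : NE.relIndex (ι.range ⊔ NE) = NE.relIndex ι.range := AddSubgroup.relIndex_sup_right _ _
  calc NK.relIndex (NE.comap ι) * NE.index
      = NK.relIndex (NE.comap ι) * (NE.relIndex ι.range * (ι.range ⊔ NE).index) := by rw [← h3, h4]
    _ = NK.relIndex (NE.comap ι) * (NE.comap ι).index * (ι.range ⊔ NE).index := by rw [h2]; ring
    _ = NK.index * (ι.range ⊔ NE).index := by rw [h1]

include hn in
omit [CharZero E] in
/-- **PART A, assembled.** For `E` a `K`-field of characteristic `0` (a completion `K_v`):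
`#(Sel⁽ⁿ⁾(E/K) ∩ ker res_E) · [(W⁄E)(E) : n(W⁄E)(E)] ≤
  #Ш(E/K)[n] · [E(K) : nE(K)] · [(W⁄E)(E) : n(W⁄E)(E) + im E(K)]`.
At `E = K_𝔭` with (iv), `rank E(K) = 1`: `[E(K):nE(K)] = [E(K_𝔭):nE(K_𝔭)] = p^k` and the last index is
`p^{min(k,e)}` (`BDPRouteLocalIndex`) — Steps 1–2 of Jetchev–Skinner–Wan 2017 Prop. 3.2.1 (`≤`).
[cite: JetchevSkinnerWan2017, Prop. 3.2.1 (proof, arXiv:1512.06894 pp. 10–11)] [cite: SilvermanAEC2009, Thm X.4.2] -/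
theorem natCard_selmerGroup_inf_ker_res_mul_index_le [CharZero E]
    (hdiv : ∀ P : geomPoints W, ∃ Q : geomPoints W, n • Q = P) :
    Nat.card ↥(selmerGroup W n ⊓ (galoisCohomology.res (W.torsionGaloisModule n) E 1).ker) *
        ((zsmulAddGroupHom n : (W.baseChange E).toAffine.Point →+ _).range).index ≤
      Nat.card ↥(W.sha ⊓ AddSubgroup.torsionBy W.galH1 n) *
        (((zsmulAddGroupHom n : W.toAffine.Point →+ _).range).index *
          ((Affine.Point.baseChange (W' := W) K E).range ⊔
            (zsmulAddGroupHom n : (W.baseChange E).toAffine.Point →+ _).range).index) := by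
  rw [← relIndex_comap_mul_index W E, ← natCard_range_kummerMapTorsion_inf_ker_res W E hn hdiv, ← mul_assoc]
  exact Nat.mul_le_mul_right _ (natCard_selmerGroup_inf_ker_res_le W E hn hdiv)

end Summit.BirchSwinnertonDyer.Rank1Residual.X11b.StrictAtPlace

end
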